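import Summits.CriticalPhenomena.PercolationContinuityZ3.Theorems.PercNearOneGluingNoHeavyLowerTailThreePartitionVOrderReverseNested

/-!
# `NoHeavyLowerTail` (crux stmt-CriticalPhenomena-4575): the CENSORED three-partition kernels `𝒦₂` — the slice-closed
# ten-parameter family containing Conjecture V, and Conjecture V's two nested theorems extended to it

Support file (lineage `prim-bnk-2`, generation 26; `--supports stmt-CriticalPhenomena-4575`; memo
`run/shared/lean/prim/prim-l12/FROM-prim-bnk-2-g26-CENSORED-KERNELS.md`).  No `sorry`, standard axioms; the only unproved
statement is the `@[conjecture]`-tagged `CensoredVOrderPositivity`, used as an explicit hypothesis.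

**The family.**  Conjecture V (`VOrderPositivity`, generation 23) asks that the kernel
`K_{𝒱,𝒲}(a,b,c) = [a∈𝒲]([a∈𝒱]−[c∈𝒱]) + [a∈𝒱]([a∈𝒲]−[c∈𝒲]) + [c∈𝒱]([b∈𝒲]−[c∈𝒲])` (types `T1, T2, T3`) be up-set-nonnegative on
the face poset of the cube.  Slicing an instance along a coordinate `e` (the induction that proved THEOREM A, generation 25) does
not stay inside the two-parameter family: the free slice (`e` in the third copy) is NOT up-set-nonnegative, but its TARGETS are
exactly the targets of a "censored" kernel whose SOURCES are the free slice's sources that survive moving `e` into the first or the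
second copy.  Iterating, one is led to the ten-parameter family (memo §1)
  `𝔎[P](a,b,c) = [a∈Cx⁻]([a∈Bx⁻][c∉Bz⁺] − [a∉Bx⁺][c∈Bz⁻]) + [a∈Bx⁻]([a∈Cx⁻][c∉Cz⁺] − [a∉Cx⁺][c∈Cz⁻])`
  `          + [c∈Bz⁺][c∉Cz⁺][b∈Cy⁻] − [c∈Bz⁻][c∈Cz⁻][b∉Cy⁺]`
with nested parameters `U⁻ ⊆ U⁺` and the six cross constraints `Bz± ⊆ Bx±`, `Cz± ⊆ Cx±`, `Cz± ⊆ Cy±` (class `𝒦₂`,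
`CensoredData.Admissible`); `P = (𝒱,𝒱,𝒲,𝒲,𝒲,𝒲,𝒱,𝒱,𝒲,𝒲)` gives back `K_{𝒱,𝒲}` (`cSumT_diag`).  Equivalently: `𝒦₂`-kernels are
exactly the "internal instances" (robust sources of the free slice → targets of the free slice) of the five-parameter mixed
kernels `K[Bx,Cx,Cy,Bz,Cz]` (`Bz ⊆ Bx`, `Cz ⊆ Cx ∩ Cy`) one dimension up, and the family is closed under facets and under taking
internal instances (memo §1–§2).
**Conjecture 𝒦₂** (`CensoredVOrderPositivity`): every admissible censored kernel is up-set-nonnegative on the copy order, for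
every twist.  Census (memo §3, engines `code/t1.c,t4.c,t5.c,t11.c`): `m = 2` exhaustive (`337 344` tuples), `m = 3,4,5` random
(`6·10⁵ / 2.3·10⁵ / 2·10⁴`), twisted `m = 3,4` random (`4·10⁴`): `0` failures; each of the six cross constraints is necessary
(dropping any single one produces failures already at `m = 2`).  It implies Conjecture V (`vOrderPositivity_of_censored`).
**Theorems (this file).**  The single-type tools survive in `𝒦₂` using exactly the six cross constraints, via THEOREM A
(`triT_robust_le`, `triT_robust_le_b`): `T1⁻ → T1⁺` is Theorem A`(Bz⁻, Bx⁺; a; a)` filtered by `a ∈ Cx⁻`, `T2⁻ → T2⁺` is Theorem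
A`(Cz⁻, Cx⁺; a; a)` filtered by `a ∈ Bx⁻`, `T3⁻ → T2⁺` is Theorem A`(Bz⁻∩Cz⁻, Cy⁺; b; a)` and `T3⁻ → T3⁺ ∪ T1⁺` is Theorem
A`(Bz⁻∩Cz⁻, Cy⁺; b; σ)` with `σ(c) = b ⟺ c ∈ Bz⁺`.  Hence **Conjecture 𝒦₂ holds whenever `Bx⁻ ⊆ Cx⁺` (no `T2⁻`) or `Cx⁻ ⊆ Bx⁺`
(no `T1⁻`)** (`cSumT_nonneg_of_Bxm_subset_Cxp`, `cSumT_nonneg_of_Cxm_subset_Bxp`) — the "half-nested" censored kernels, which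
contain both nested cases of Conjecture V (`vSumT_nonneg_of_nested`, via `cSumT_diag`) and are the base of any slicing
induction inside `𝒦₂`.  The general case (both `T1⁻` and `T2⁻` present) remains open. [this work]
-/

namespace Summit.CriticalPhenomena.PercolationContinuityZ3.Theorems.ThreePartition

open Finset Function
open scoped Classical symmDiff

noncomputable section

variable {ι : Type*} [Fintype ι]

/-! ## Censored kernels -/

/-- The ten parameters of a censored three-partition kernel: for the tests on the first copy `a` ("x") the pairs
`Bx⁻ ⊆ Bx⁺`, `Cx⁻ ⊆ Cx⁺`, on the second copy `b` ("y") `Cy⁻ ⊆ Cy⁺`, on the third copy `c` ("z") `Bz⁻ ⊆ Bz⁺`, `Cz⁻ ⊆ Cz⁺`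
(the `⁻` set is the strong/positive test, the `⁺` set the weak one). [this work] -/
structure CensoredData (ι : Type*) where
  /-- strong `B`-test on copy `a` -/
  Bxm : Set (Set ι)
  /-- weak `B`-test on copy `a` -/
  Bxp : Set (Set ι)
  /-- strong `C`-test on copy `a` -/
  Cxm : Set (Set ι)
  /-- weak `C`-test on copy `a` -/
  Cxp : Set (Set ι)
  /-- strong `C`-test on copy `b` -/
  Cym : Set (Set ι)
  /-- weak `C`-test on copy `b` -/
  Cyp : Set (Set ι)
  /-- strong `B`-test on copy `c` -/
  Bzm : Set (Set ι)
  /-- weak `B`-test on copy `c` -/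
  Bzp : Set (Set ι)
  /-- strong `C`-test on copy `c` -/
  Czm : Set (Set ι)
  /-- weak `C`-test on copy `c` -/
  Czp : Set (Set ι)

/-- **The class `𝒦₂`**: all ten parameters are up-sets, `U⁻ ⊆ U⁺` slotwise, and the six cross constraints
`Bz± ⊆ Bx±`, `Cz± ⊆ Cx±`, `Cz± ⊆ Cy±` hold (each is necessary for up-set-nonnegativity, memo §3).  A definition (the
hypothesis class of Conjecture 𝒦₂), not a cited fact. [this work] -/
structure CensoredData.Admissible (P : CensoredData ι) : Prop where
  /-- up-set -/
  hBxm : IsUpperSet P.Bxm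
  /-- up-set -/
  hBxp : IsUpperSet P.Bxp
  /-- up-set -/
  hCxm : IsUpperSet P.Cxm
  /-- up-set -/
  hCxp : IsUpperSet P.Cxp
  /-- up-set -/
  hCym : IsUpperSet P.Cym
  /-- up-set -/
  hCyp : IsUpperSet P.Cyp
  /-- up-set -/
  hBzm : IsUpperSet P.Bzm
  /-- up-set -/
  hBzp : IsUpperSet P.Bzp
  /-- up-set -/
  hCzm : IsUpperSet P.Czm
  /-- up-set -/
  hCzp : IsUpperSet P.Czp
  /-- nesting -/
  Bx_le : P.Bxm ⊆ P.Bxp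
  /-- nesting -/
  Cx_le : P.Cxm ⊆ P.Cxp
  /-- nesting -/
  Cy_le : P.Cym ⊆ P.Cyp
  /-- nesting -/
  Bz_le : P.Bzm ⊆ P.Bzp
  /-- nesting -/
  Cz_le : P.Czm ⊆ P.Czp
  /-- cross constraint -/
  Bzm_Bxm : P.Bzm ⊆ P.Bxm
  /-- cross constraint -/
  Bzp_Bxp : P.Bzp ⊆ P.Bxp
  /-- cross constraint -/
  Czm_Cxm : P.Czm ⊆ P.Cxm
  /-- cross constraint -/
  Czp_Cxp : P.Czp ⊆ P.Cxp
  /-- cross constraint -/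
  Czm_Cym : P.Czm ⊆ P.Cym
  /-- cross constraint -/
  Czp_Cyp : P.Czp ⊆ P.Cyp

/-- **The censored kernel sum** over the 3-partitions whose pair of first copies lies in `𝒳`: the six typed counts
`T1⁺ − T1⁻ + T2⁺ − T2⁻ + T3⁺ − T3⁻` with
`T1⁺ = [a∈Cx⁻][a∈Bx⁻][c∉Bz⁺]`, `T1⁻ = [a∈Cx⁻][a∉Bx⁺][c∈Bz⁻]`, `T2⁺ = [a∈Bx⁻][a∈Cx⁻][c∉Cz⁺]`, `T2⁻ = [a∈Bx⁻][a∉Cx⁺][c∈Cz⁻]`,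
`T3⁺ = [c∈Bz⁺][c∉Cz⁺][b∈Cy⁻]`, `T3⁻ = [c∈Bz⁻][c∈Cz⁻][b∉Cy⁺]`. [this work] -/
def cSumT (τ : Set ι) (P : CensoredData ι) (𝒳 : Set (Set ι × Set ι)) : ℤ :=
  ((triT τ fun a b c => (a, b) ∈ 𝒳 ∧ a ∈ P.Cxm ∧ a ∈ P.Bxm ∧ c ∉ P.Bzp : ℕ) : ℤ)
    - (triT τ fun a b c => (a, b) ∈ 𝒳 ∧ a ∈ P.Cxm ∧ a ∉ P.Bxp ∧ c ∈ P.Bzm : ℕ)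
    + (triT τ fun a b c => (a, b) ∈ 𝒳 ∧ a ∈ P.Bxm ∧ a ∈ P.Cxm ∧ c ∉ P.Czp : ℕ)
    - (triT τ fun a b c => (a, b) ∈ 𝒳 ∧ a ∈ P.Bxm ∧ a ∉ P.Cxp ∧ c ∈ P.Czm : ℕ)
    + (triT τ fun a b c => (a, b) ∈ 𝒳 ∧ c ∈ P.Bzp ∧ c ∉ P.Czp ∧ b ∈ P.Cym : ℕ)
    - (triT τ fun a b c => (a, b) ∈ 𝒳 ∧ c ∈ P.Bzm ∧ c ∈ P.Czm ∧ b ∉ P.Cyp : ℕ)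

/-- The diagonal (uncensored) data of a pair `(𝒱, 𝒲)`: `B = 𝒱` everywhere, `C = 𝒲` everywhere. [this work] -/
def CensoredData.diag (𝒱 𝒲 : Set (Set ι)) : CensoredData ι :=
  ⟨𝒱, 𝒱, 𝒲, 𝒲, 𝒲, 𝒲, 𝒱, 𝒱, 𝒲, 𝒲⟩

omit [Fintype ι] in
/-- Diagonal data of two up-sets are admissible. [this work] -/
theorem CensoredData.diag_admissible {𝒱 𝒲 : Set (Set ι)} (h𝒱 : IsUpperSet 𝒱) (h𝒲 : IsUpperSet 𝒲) :
    (CensoredData.diag 𝒱 𝒲).Admissible :=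
  ⟨h𝒱, h𝒱, h𝒲, h𝒲, h𝒲, h𝒲, h𝒱, h𝒱, h𝒲, h𝒲, subset_rfl, subset_rfl, subset_rfl, subset_rfl, subset_rfl,
    subset_rfl, subset_rfl, subset_rfl, subset_rfl, subset_rfl, subset_rfl⟩

/-- **CONJECTURE 𝒦₂** (this work; OPEN): every admissible censored kernel is up-set-nonnegative on the copy order, for every
finite ground set, every twist `τ` and every up-set `𝒳` of pairs.  Census `m ≤ 5` (exhaustive at `m = 2`, random above, twisted
`m ≤ 4`): `0` failures; contains Conjecture V (`vOrderPositivity_of_censored`).  An obligation of our theories, never a fact: use as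
`(h : CensoredVOrderPositivity)`. [status: open] -/
@[conjecture] def CensoredVOrderPositivity : Prop :=
  ∀ (ι : Type) [Fintype ι] (τ : Set ι) (P : CensoredData ι) (𝒳 : Set (Set ι × Set ι)),
    P.Admissible → IsUpperSet 𝒳 → 0 ≤ cSumT τ P 𝒳

/-! ## Bookkeeping lemmas -/

/-- Monotonicity of `triT` in the predicate. [this work] -/
theorem triT_mono (τ : Set ι) {p q : Set ι → Set ι → Set ι → Prop} (h : ∀ a b c, p a b c → q a b c) :
    triT τ p ≤ triT τ q := by
  unfold triT
  exact tri_mono fun S₁ S₂ _ hp => h _ _ _ hp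

/-- A `triT` count of an unsatisfiable predicate vanishes. [this work] -/
theorem triT_eq_zero (τ : Set ι) {p : Set ι → Set ι → Set ι → Prop} (h : ∀ a b c, ¬ p a b c) : triT τ p = 0 := by
  unfold triT tri
  rw [Finset.card_eq_zero, Finset.filter_eq_empty_iff]
  intro x _ hx
  exact h _ _ _ hx.2

/-- **The diagonal censored kernel is Conjecture V's kernel**: `cSumT τ (diag 𝒱 𝒲) 𝒳 = vSumT τ 𝒱 𝒲 𝒳`
(`T1 + T2 + T3` regrouped into the five counts of `vSumT` by inclusion–exclusion). [this work] -/
theorem cSumT_diag (τ : Set ι) (𝒱 𝒲 : Set (Set ι)) (𝒳 : Set (Set ι × Set ι)) :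
    cSumT τ (CensoredData.diag 𝒱 𝒲) 𝒳 = vSumT τ 𝒱 𝒲 𝒳 := by
  -- T1: `[a∈𝒲]([a∈𝒱][c∉𝒱] − [a∉𝒱][c∈𝒱]) = [a∈𝒱𝒲] − [a∈𝒲][c∈𝒱]`
  have s1 := triT_and_add_triT_and_not τ (fun a b _ => (a, b) ∈ 𝒳 ∧ a ∈ 𝒱 ∧ a ∈ 𝒲) (fun _ _ c => c ∈ 𝒱)
  have s2 := triT_and_add_triT_and_not τ (fun a b c => (a, b) ∈ 𝒳 ∧ a ∈ 𝒲 ∧ c ∈ 𝒱) (fun a _ _ => a ∈ 𝒱)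
  have e1 : triT τ (fun a b c => ((a, b) ∈ 𝒳 ∧ a ∈ 𝒱 ∧ a ∈ 𝒲) ∧ ¬ c ∈ 𝒱) =
      triT τ (fun a b c => (a, b) ∈ 𝒳 ∧ a ∈ 𝒲 ∧ a ∈ 𝒱 ∧ c ∉ 𝒱) := triT_congr fun a b c => by tauto
  have e2 : triT τ (fun a b c => ((a, b) ∈ 𝒳 ∧ a ∈ 𝒲 ∧ c ∈ 𝒱) ∧ ¬ a ∈ 𝒱) =
      triT τ (fun a b c => (a, b) ∈ 𝒳 ∧ a ∈ 𝒲 ∧ a ∉ 𝒱 ∧ c ∈ 𝒱) := triT_congr fun a b c => by tauto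
  have e12 : triT τ (fun a b c => ((a, b) ∈ 𝒳 ∧ a ∈ 𝒲 ∧ c ∈ 𝒱) ∧ a ∈ 𝒱) =
      triT τ (fun a b c => ((a, b) ∈ 𝒳 ∧ a ∈ 𝒱 ∧ a ∈ 𝒲) ∧ c ∈ 𝒱) := triT_congr fun a b c => by tauto
  -- T2: `[a∈𝒱]([a∈𝒲][c∉𝒲] − [a∉𝒲][c∈𝒲]) = [a∈𝒱𝒲] − [a∈𝒱][c∈𝒲]`
  have s3 := triT_and_add_triT_and_not τ (fun a b _ => (a, b) ∈ 𝒳 ∧ a ∈ 𝒱 ∧ a ∈ 𝒲) (fun _ _ c => c ∈ 𝒲)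
  have s4 := triT_and_add_triT_and_not τ (fun a b c => (a, b) ∈ 𝒳 ∧ a ∈ 𝒱 ∧ c ∈ 𝒲) (fun a _ _ => a ∈ 𝒲)
  have e3 : triT τ (fun a b c => ((a, b) ∈ 𝒳 ∧ a ∈ 𝒱 ∧ a ∈ 𝒲) ∧ ¬ c ∈ 𝒲) =
      triT τ (fun a b c => (a, b) ∈ 𝒳 ∧ a ∈ 𝒱 ∧ a ∈ 𝒲 ∧ c ∉ 𝒲) := triT_congr fun a b c => by tauto
  have e4 : triT τ (fun a b c => ((a, b) ∈ 𝒳 ∧ a ∈ 𝒱 ∧ c ∈ 𝒲) ∧ ¬ a ∈ 𝒲) =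
      triT τ (fun a b c => (a, b) ∈ 𝒳 ∧ a ∈ 𝒱 ∧ a ∉ 𝒲 ∧ c ∈ 𝒲) := triT_congr fun a b c => by tauto
  have e34 : triT τ (fun a b c => ((a, b) ∈ 𝒳 ∧ a ∈ 𝒱 ∧ c ∈ 𝒲) ∧ a ∈ 𝒲) =
      triT τ (fun a b c => ((a, b) ∈ 𝒳 ∧ a ∈ 𝒱 ∧ a ∈ 𝒲) ∧ c ∈ 𝒲) := triT_congr fun a b c => by tauto
  -- T3: `[c∈𝒱]([c∉𝒲][b∈𝒲] − [c∈𝒲][b∉𝒲]) = [c∈𝒱][b∈𝒲] − [c∈𝒱𝒲]`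
  have s5 := triT_and_add_triT_and_not τ (fun a b c => (a, b) ∈ 𝒳 ∧ c ∈ 𝒱 ∧ b ∈ 𝒲) (fun _ _ c => c ∈ 𝒲)
  have s6 := triT_and_add_triT_and_not τ (fun a b c => (a, b) ∈ 𝒳 ∧ c ∈ 𝒱 ∧ c ∈ 𝒲) (fun _ b _ => b ∈ 𝒲)
  have e5 : triT τ (fun a b c => ((a, b) ∈ 𝒳 ∧ c ∈ 𝒱 ∧ b ∈ 𝒲) ∧ ¬ c ∈ 𝒲) =
      triT τ (fun a b c => (a, b) ∈ 𝒳 ∧ c ∈ 𝒱 ∧ c ∉ 𝒲 ∧ b ∈ 𝒲) := triT_congr fun a b c => by tauto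
  have e6 : triT τ (fun a b c => ((a, b) ∈ 𝒳 ∧ c ∈ 𝒱 ∧ c ∈ 𝒲) ∧ ¬ b ∈ 𝒲) =
      triT τ (fun a b c => (a, b) ∈ 𝒳 ∧ c ∈ 𝒱 ∧ c ∈ 𝒲 ∧ b ∉ 𝒲) := triT_congr fun a b c => by tauto
  have e56 : triT τ (fun a b c => ((a, b) ∈ 𝒳 ∧ c ∈ 𝒱 ∧ c ∈ 𝒲) ∧ b ∈ 𝒲) =
      triT τ (fun a b c => ((a, b) ∈ 𝒳 ∧ c ∈ 𝒱 ∧ b ∈ 𝒲) ∧ c ∈ 𝒲) := triT_congr fun a b c => by tauto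
  rw [e1] at s1; rw [e2, e12] at s2; rw [e3] at s3; rw [e4, e34] at s4; rw [e5] at s5; rw [e6, e56] at s6
  unfold cSumT vSumT CensoredData.diag
  simp only []
  have s1' := congrArg (fun n : ℕ => (n : ℤ)) s1
  have s2' := congrArg (fun n : ℕ => (n : ℤ)) s2
  have s3' := congrArg (fun n : ℕ => (n : ℤ)) s3
  have s4' := congrArg (fun n : ℕ => (n : ℤ)) s4
  have s5' := congrArg (fun n : ℕ => (n : ℤ)) s5
  have s6' := congrArg (fun n : ℕ => (n : ℤ)) s6
  simp only [Nat.cast_add] at s1' s2' s3' s4' s5' s6'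
  push_cast
  linarith

/-- **Conjecture 𝒦₂ implies Conjecture V** (hence `ThreePartitionPositivityTwisted` and Sahi's `C₃` / Kahn's conjecture, via
`masterFamilyNonneg_three_of_vOrderPositivity`). [this work] -/
theorem vOrderPositivity_of_censored (h : CensoredVOrderPositivity) : VOrderPositivity := by
  intro ι _ τ 𝒱 𝒲 𝒳 h𝒱 h𝒲 h𝒳
  rw [← cSumT_diag]
  exact h ι τ _ 𝒳 (CensoredData.diag_admissible h𝒱 h𝒲) h𝒳

/-! ## The single-type tools in `𝒦₂` (THEOREM A) -/

/-- **`T1⁻ → T1⁺` in `𝒦₂`**: `#{a∈Cx⁻, a∉Bx⁺, c∈Bz⁻} ≤ #{a∈Cx⁻, a∈Bx⁻, c∉Bz⁺}` on every up-set `𝒳` of the copy order —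
Theorem A`(G = Bz⁻, H = Bx⁺; a; a)` filtered by the up-set `a ∈ Cx⁻`, using `Bz⁻ ⊆ Bx⁻` and `Bz⁺ ⊆ Bx⁺`. [this work] -/
theorem triT_T1_le (τ : Set ι) {𝒳 : Set (Set ι × Set ι)} (h𝒳 : IsUpperSet 𝒳) {Bxm Bxp Cxm Bzm Bzp : Set (Set ι)}
    (hCxm : IsUpperSet Cxm) (hBxp : IsUpperSet Bxp) (hBzm : IsUpperSet Bzm) (hzx : Bzm ⊆ Bxm) (hzx' : Bzp ⊆ Bxp) :
    triT τ (fun a b c => (a, b) ∈ 𝒳 ∧ a ∈ Cxm ∧ a ∉ Bxp ∧ c ∈ Bzm) ≤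
      triT τ (fun a b c => (a, b) ∈ 𝒳 ∧ a ∈ Cxm ∧ a ∈ Bxm ∧ c ∉ Bzp) := by
  have h𝒳' : IsUpperSet {q : Set ι × Set ι | q ∈ 𝒳 ∧ q.1 ∈ Cxm} := fun _ _ hle hq =>
    ⟨h𝒳 hle hq.1, hCxm (Prod.mk_le_mk.1 hle).1 hq.2⟩
  have h := triT_robust_le τ h𝒳' hBzm hBxp (fun _ => false)
  refine le_trans (le_of_eq (triT_congr fun a b c => ?_)) (le_trans h (triT_mono τ fun a b c hq => ?_))
  · simp only [Set.mem_setOf_eq]; tauto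
  · simp only [Set.mem_setOf_eq, Bool.false_eq_true, ↓reduceIte] at hq
    exact ⟨hq.1.1, hq.1.2, hzx hq.2.2, fun hc => hq.2.1 (hzx' hc)⟩

/-- **`T2⁻ → T2⁺` in `𝒦₂`**: Theorem A`(G = Cz⁻, H = Cx⁺; a; a)` filtered by `a ∈ Bx⁻`, using `Cz⁻ ⊆ Cx⁻`, `Cz⁺ ⊆ Cx⁺`.
[this work] -/
theorem triT_T2_le (τ : Set ι) {𝒳 : Set (Set ι × Set ι)} (h𝒳 : IsUpperSet 𝒳) {Bxm Cxm Cxp Czm Czp : Set (Set ι)}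
    (hBxm : IsUpperSet Bxm) (hCxp : IsUpperSet Cxp) (hCzm : IsUpperSet Czm) (hzx : Czm ⊆ Cxm) (hzx' : Czp ⊆ Cxp) :
    triT τ (fun a b c => (a, b) ∈ 𝒳 ∧ a ∈ Bxm ∧ a ∉ Cxp ∧ c ∈ Czm) ≤
      triT τ (fun a b c => (a, b) ∈ 𝒳 ∧ a ∈ Bxm ∧ a ∈ Cxm ∧ c ∉ Czp) :=
  triT_T1_le τ h𝒳 hBxm hCxp hCzm hzx hzx'

/-- **`T3⁻ → T2⁺` in `𝒦₂`** (the censored Theorem U): `#{c∈Bz⁻∩Cz⁻, b∉Cy⁺} ≤ #{a∈Bx⁻∩Cx⁻, c∉Cz⁺}` — Theorem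
A`(G = Bz⁻∩Cz⁻, H = Cy⁺; b; a)`, using `Bz⁻ ⊆ Bx⁻`, `Cz⁻ ⊆ Cx⁻`, `Cz⁺ ⊆ Cy⁺`. [this work] -/
theorem triT_T3_le_T2 (τ : Set ι) {𝒳 : Set (Set ι × Set ι)} (h𝒳 : IsUpperSet 𝒳) {Bxm Cxm Cyp Bzm Czm Czp : Set (Set ι)}
    (hCyp : IsUpperSet Cyp) (hBzm : IsUpperSet Bzm) (hCzm : IsUpperSet Czm) (hBzx : Bzm ⊆ Bxm) (hCzx : Czm ⊆ Cxm)
    (hCzy : Czp ⊆ Cyp) :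
    triT τ (fun a b c => (a, b) ∈ 𝒳 ∧ c ∈ Bzm ∧ c ∈ Czm ∧ b ∉ Cyp) ≤
      triT τ (fun a b c => (a, b) ∈ 𝒳 ∧ a ∈ Bxm ∧ a ∈ Cxm ∧ c ∉ Czp) := by
  have hG : IsUpperSet (Bzm ∩ Czm) := hBzm.inter hCzm
  have h := triT_robust_le_b τ h𝒳 hG hCyp (fun _ => false)
  refine le_trans (le_of_eq (triT_congr fun a b c => ?_)) (le_trans h (triT_mono τ fun a b c hq => ?_))
  · simp only [Set.mem_inter_iff]; tauto
  · simp only [Set.mem_inter_iff, Bool.false_eq_true, ↓reduceIte] at hq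
    exact ⟨hq.1, hBzx hq.2.2.1, hCzx hq.2.2.2, fun hc => hq.2.1 (hCzy hc)⟩

/-- **`T3⁻ → T3⁺ ∪ T1⁺` in `𝒦₂`**: `#{c∈Bz⁻∩Cz⁻, b∉Cy⁺} ≤ #{c∈Bz⁺, c∉Cz⁺, b∈Cy⁻} + #{a∈Cx⁻∩Bx⁻, c∉Bz⁺}` — Theorem
A`(G = Bz⁻∩Cz⁻, H = Cy⁺; b; σ)` with the layer-dependent side `σ(c) = b ⟺ c ∈ Bz⁺`, using `Bz⁻ ⊆ Bx⁻`, `Cz⁻ ⊆ Cx⁻`,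
`Cz⁻ ⊆ Cy⁻`, `Cz⁺ ⊆ Cy⁺`. [this work] -/
theorem triT_T3_le_T3_add_T1 (τ : Set ι) {𝒳 : Set (Set ι × Set ι)} (h𝒳 : IsUpperSet 𝒳)
    {Bxm Cxm Cym Cyp Bzm Bzp Czm Czp : Set (Set ι)}
    (hCyp : IsUpperSet Cyp) (hBzm : IsUpperSet Bzm) (hCzm : IsUpperSet Czm) (hBzx : Bzm ⊆ Bxm) (hCzx : Czm ⊆ Cxm)
    (hCzy : Czm ⊆ Cym) (hCzy' : Czp ⊆ Cyp) :
    triT τ (fun a b c => (a, b) ∈ 𝒳 ∧ c ∈ Bzm ∧ c ∈ Czm ∧ b ∉ Cyp) ≤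
      triT τ (fun a b c => (a, b) ∈ 𝒳 ∧ c ∈ Bzp ∧ c ∉ Czp ∧ b ∈ Cym)
        + triT τ (fun a b c => (a, b) ∈ 𝒳 ∧ a ∈ Cxm ∧ a ∈ Bxm ∧ c ∉ Bzp) := by
  have hG : IsUpperSet (Bzm ∩ Czm) := hBzm.inter hCzm
  have h := triT_robust_le_b τ h𝒳 hG hCyp (fun c => decide (c ∈ Bzp))
  have hs := triT_and_add_triT_and_not τ
    (fun a b c => (a, b) ∈ 𝒳 ∧ c ∉ Cyp ∧ (if decide (c ∈ Bzp) then b ∈ Bzm ∩ Czm else a ∈ Bzm ∩ Czm))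
    (fun _ _ c => c ∈ Bzp)
  have hb : triT τ (fun a b c => ((a, b) ∈ 𝒳 ∧ c ∉ Cyp ∧
        (if decide (c ∈ Bzp) then b ∈ Bzm ∩ Czm else a ∈ Bzm ∩ Czm)) ∧ c ∈ Bzp) ≤
      triT τ (fun a b c => (a, b) ∈ 𝒳 ∧ c ∈ Bzp ∧ c ∉ Czp ∧ b ∈ Cym) :=
    triT_mono τ fun a b c hq => by
      obtain ⟨⟨hX, hc, hif⟩, hcB⟩ := hq
      simp only [hcB, decide_true, ↓reduceIte, Set.mem_inter_iff] at hif
      exact ⟨hX, hcB, fun hc' => hc (hCzy' hc'), hCzy hif.2⟩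
  have ha : triT τ (fun a b c => ((a, b) ∈ 𝒳 ∧ c ∉ Cyp ∧
        (if decide (c ∈ Bzp) then b ∈ Bzm ∩ Czm else a ∈ Bzm ∩ Czm)) ∧ ¬ c ∈ Bzp) ≤
      triT τ (fun a b c => (a, b) ∈ 𝒳 ∧ a ∈ Cxm ∧ a ∈ Bxm ∧ c ∉ Bzp) :=
    triT_mono τ fun a b c hq => by
      obtain ⟨⟨hX, _, hif⟩, hcB⟩ := hq
      simp only [hcB, decide_false, Bool.false_eq_true, ↓reduceIte, Set.mem_inter_iff] at hif
      exact ⟨hX, hCzx hif.2, hBzx hif.1, hcB⟩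
  have e0 : triT τ (fun a b c => (a, b) ∈ 𝒳 ∧ c ∈ Bzm ∧ c ∈ Czm ∧ b ∉ Cyp) =
      triT τ (fun a b c => (a, b) ∈ 𝒳 ∧ c ∈ Bzm ∩ Czm ∧ b ∉ Cyp) :=
    triT_congr fun a b c => by simp only [Set.mem_inter_iff]; tauto
  rw [e0]
  omega

/-! ## Conjecture 𝒦₂ on the half-nested classes -/

/-- **Conjecture 𝒦₂ holds when `Bx⁻ ⊆ Cx⁺`** (no `T2⁻` sources; contains Conjecture V for `𝒱 ⊆ 𝒲`): route `T1⁻ → T1⁺`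
(`triT_T1_le`) and `T3⁻ → T2⁺` (`triT_T3_le_T2`); `T3⁺` is surplus.  All twists, all up-sets `𝒳` of the copy order. [this work] -/
theorem cSumT_nonneg_of_Bxm_subset_Cxp (τ : Set ι) {P : CensoredData ι} (hP : P.Admissible) {𝒳 : Set (Set ι × Set ι)}
    (h𝒳 : IsUpperSet 𝒳) (h : P.Bxm ⊆ P.Cxp) : 0 ≤ cSumT τ P 𝒳 := by
  have h2 : triT τ (fun a b c => (a, b) ∈ 𝒳 ∧ a ∈ P.Bxm ∧ a ∉ P.Cxp ∧ c ∈ P.Czm) = 0 :=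
    triT_eq_zero τ fun a b c hq => hq.2.2.1 (h hq.2.1)
  have h1 := Int.ofNat_le.2 (triT_T1_le τ h𝒳 hP.hCxm hP.hBxp hP.hBzm hP.Bzm_Bxm hP.Bzp_Bxp)
  have h3 := Int.ofNat_le.2 (triT_T3_le_T2 τ h𝒳 hP.hCyp hP.hBzm hP.hCzm hP.Bzm_Bxm hP.Czm_Cxm hP.Czp_Cyp)
  unfold cSumT
  rw [h2]
  push_cast at h1 h3 ⊢
  have h0 : (0 : ℤ) ≤ (triT τ fun a b c => (a, b) ∈ 𝒳 ∧ c ∈ P.Bzp ∧ c ∉ P.Czp ∧ b ∈ P.Cym : ℕ) := Int.natCast_nonneg _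
  linarith

/-- **Conjecture 𝒦₂ holds when `Cx⁻ ⊆ Bx⁺`** (no `T1⁻` sources; contains Conjecture V for `𝒲 ⊆ 𝒱`): route `T2⁻ → T2⁺`
(`triT_T2_le`) and `T3⁻ → T3⁺ ∪ T1⁺` with the layer-dependent side `σ(c) = b ⟺ c ∈ Bz⁺` (`triT_T3_le_T3_add_T1`).
All twists, all up-sets `𝒳` of the copy order. [this work] -/
theorem cSumT_nonneg_of_Cxm_subset_Bxp (τ : Set ι) {P : CensoredData ι} (hP : P.Admissible) {𝒳 : Set (Set ι × Set ι)}
    (h𝒳 : IsUpperSet 𝒳) (h : P.Cxm ⊆ P.Bxp) : 0 ≤ cSumT τ P 𝒳 := by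
  have h1 : triT τ (fun a b c => (a, b) ∈ 𝒳 ∧ a ∈ P.Cxm ∧ a ∉ P.Bxp ∧ c ∈ P.Bzm) = 0 :=
    triT_eq_zero τ fun a b c hq => hq.2.2.1 (h hq.2.1)
  have h2 := Int.ofNat_le.2 (triT_T2_le τ h𝒳 hP.hBxm hP.hCxp hP.hCzm hP.Czm_Cxm hP.Czp_Cxp)
  have h3 := Int.ofNat_le.2
    (triT_T3_le_T3_add_T1 τ h𝒳 (Bzp := P.Bzp) hP.hCyp hP.hBzm hP.hCzm hP.Bzm_Bxm hP.Czm_Cxm hP.Czm_Cym hP.Czp_Cyp)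
  unfold cSumT
  rw [h1]
  push_cast at h2 h3 ⊢
  linarith

/-- **Conjecture 𝒦₂ on the half-nested class** (`Bx⁻ ⊆ Cx⁺` or `Cx⁻ ⊆ Bx⁺`). [this work] -/
theorem cSumT_nonneg_of_halfNested (τ : Set ι) {P : CensoredData ι} (hP : P.Admissible) {𝒳 : Set (Set ι × Set ι)}
    (h𝒳 : IsUpperSet 𝒳) (h : P.Bxm ⊆ P.Cxp ∨ P.Cxm ⊆ P.Bxp) : 0 ≤ cSumT τ P 𝒳 := by
  rcases h with h | h
  · exact cSumT_nonneg_of_Bxm_subset_Cxp τ hP h𝒳 h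
  · exact cSumT_nonneg_of_Cxm_subset_Bxp τ hP h𝒳 h

/-! ## Erratum (generation 26, later census): the ALL-TWIST form of Conjecture 𝒦₂ is false; the untwisted form stands -/

/-- **CONJECTURE 𝒦₂, UNTWISTED FORM** (this work; OPEN) — and an ERRATUM to `CensoredVOrderPositivity` above.  The all-twist statement
`CensoredVOrderPositivity` is FALSE: the large census (kit job `j195455`, `3.8·10⁸` random admissible tuples with random twists, `m = 4,5,6`) found
nine failures, ALL at non-empty twists, e.g. `m = 4`, `ι = Fin 4`, twist `τ = {1,2,3}`, up-sets as 16-bit masks over `𝒫(Fin 4)`: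
`Bx⁻ = f0f0, Bx⁺ = fff8, Cx⁻ = cccc, Cx⁺ = ffcc, Cy⁻ = Cy⁺ = ff00, Bz⁻ = f0a0, Bz⁺ = ffa0, Cz⁻ = cc00, Cz⁺ = ff00` has an up-set `𝒳` of the
copy order with `cSumT τ P 𝒳 = −1` (memo §3; each witness is fine at `τ = ∅`, and its five-parameter lift one dimension up is up-set-nonnegative —
so for a twisted ambient cube even the robust sources of an untwisted free slice need not route internally).  No failure is known at `τ = ∅`
(`> 2·10⁷` untwisted samples at `m = 4,5`, exhaustive `m = 2`, plus kit job `j198794`), which is the form the untwisted slicing step produces; the twisted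
step has a different internal instance (memo §5).  So the conjecture to use is this one; it no longer implies `VOrderPositivity` for all twists by
itself (`vOrderPositivity_of_censored` needs the false all-twist form), only its `τ = ∅` case.  An obligation, never a fact. [status: open] -/
@[conjecture] def CensoredVOrderPositivityUntwisted : Prop :=
  ∀ (ι : Type) [Fintype ι] (P : CensoredData ι) (𝒳 : Set (Set ι × Set ι)),
    P.Admissible → IsUpperSet 𝒳 → 0 ≤ cSumT (∅ : Set ι) P 𝒳

/-- The (false) all-twist form trivially contains the untwisted form. [this work] -/
theorem censoredVOrderPositivityUntwisted_of_censored (h : CensoredVOrderPositivity) : CensoredVOrderPositivityUntwisted :=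
  fun ι _ P 𝒳 hP h𝒳 => h ι ∅ P 𝒳 hP h𝒳

/-- **Untwisted Conjecture 𝒦₂ ⟹ untwisted Conjecture V**: `vSumT ∅ 𝒱 𝒲 𝒳 ≥ 0` for all up-sets (the `τ = ∅` slice of `VOrderPositivity`,
i.e. the E₃ kernel is nonnegative on every subcomplex of the cube). [this work] -/
theorem vSumT_empty_nonneg_of_censoredUntwisted (h : CensoredVOrderPositivityUntwisted) {ι : Type} [Fintype ι]
    {𝒱 𝒲 : Set (Set ι)} {𝒳 : Set (Set ι × Set ι)} (h𝒱 : IsUpperSet 𝒱) (h𝒲 : IsUpperSet 𝒲) (h𝒳 : IsUpperSet 𝒳) :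
    0 ≤ vSumT (∅ : Set ι) 𝒱 𝒲 𝒳 := by
  rw [← cSumT_diag]
  exact h ι _ 𝒳 (CensoredData.diag_admissible h𝒱 h𝒲) h𝒳

end

end Summit.CriticalPhenomena.PercolationContinuityZ3.Theorems.ThreePartition
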